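import Summits.ABC.IUTFork.Repair.RHHullThresholdExactRefute
import HarnessLib

/-!
# R-W lane P− at WILD places: the hull-threshold cell with a FREE certified different bound `δ` — arithmetic bridge and setting-level
# consumer («cell FAILS at one bad place with `(e, P_q, r_in, r_out, δ)` ⟹ the (xi-f) licence FAILS»)

PROOF-ONLY file (D-0012: 0 definitions, 0 `Prop` facts, no instance, no notation) of the abc-iut cell (rung LADDER-ABC:A2.RESCUE.W, lane P−
«margin < 0: explicit countermodel»; seat abc-iut-w4-d094 gen 8, row «W:FREY-PINNED-28» = the 28 «refuted at pinned types only» Frey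
(datum, l) of the R-W numerics lead's `REFUTED-CERTS-PENDING-CLASS.tsv`, all at the wild prime `p = 3`). TAKES NO SIDE on [IUTchIII] Cor. 3.12
(S. Mochizuki, *Inter-universal Teichmüller theory III*, Cor. 3.12 p. 173–174, Step (xi-f) p. 184) or on any author: every statement is about
OUR typed objects (abc-iut-c312-7's `Thm311.Real.settingPrVolSharp`, abc-iut-c312-5's `presAt` / typed (Ind1)(Ind2), abc-iut-c312-1's
`Thm311ToCor312.Licence`); the hull-level licence is a STRONGER-THAN-PRINT reading of Step (xi-f); typed ≠ proved; refuted-as-typed ≠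
refuted-in-print; nothing here asserts abc proved or refuted.

WHY. abc-iut-rh-typ-4's NEG consumer `RH.HullThresholdExactRefute.not_licence_settingPrVolSharp_of_not_hullCell` (p462895) hard-wires the
different of the diagonal packet as `(e − 1)/e` — its hypothesis `dSum − d_J ≤ (i+1)(e−1)/e` holds at TAME places only (the caveat recorded by
abc-iut-lens-nearmiss-2: «exact NEG needs `D_J ≤ j·δ_w/e_w`»). At the WILD poles `p ∈ {3, 5}` of the Frey data the different is larger
(Dedekind: up to `e − 1 + ord(e)`), so the R-W numerics lead's pending rows are stated with an explicit `δ` («Lenstra max»). THIS FILE is the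
`δ`-generalisation, same proofs:
* §1 `FreyHullThreshold.not_criterion_of_cellFail` — the arithmetic bridge (`δ = e − 1` is p459342's `not_criterion_of_not_hullCell`): with
  `‖t_q‖ = p^{−m_q/e}`, `‖t_Θ‖ = p^{−j²m_q/e}`, `Π_in ≥ p^{−(j+1)r_in/e}`, `Π_out ≤ p^{−(j+1)r_out/e}`, `D_J ≤ j·δ/e` and the INLINE cell failure
  `m_q − (j+1)r_out < e·⌊(j²m_q − jδ − (j+1)r_in)/e⌋` (no new definition: the `δ`-cell is spelled out), c312-5's criterion fails;
  `cellFail_mono` (antitone in `δ`, `r_in`; monotone in `r_out`).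
* §2 `not_licence_settingPrVolSharp_of_cellFail` / `not_exists_qPinned_and_hull_settingPrVolSharp_of_cellFail` — the consumer at
  `settingPrVolSharp X …` for realising ideles through abc-iut-w4-d036's U2-LICENCE-WRAPPER (`licence_settingPrVolSharp_iff_shellRadii_of_realises`,
  p460573) at the diagonal summand, hypotheses BY NAME: `P_q(w) = P`, `p^{−r_in/e} ≤ ‖cin w‖`, `‖cout w‖ ≤ p^{−r_out/e}`,
  `dSum − d_J ≤ (i+1)·δ/e`, and the cell failure.
The genuine-`K` engine that discharges these inputs at the wild poles of Frey rational points (Dedekind's `δ`, the local-type class) is the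
sibling `Conditional/FreyHullThresholdGenuineWild.lean`.
[cite: Mochizuki2012, IUTchIII Cor. 3.12 p. 173–174, Step (xi-f) p. 184; IUTchIV Prop. 1.1 p. 9, Prop. 1.2 (i)(ii) p. 10]
[cite: DupuyHilado2025, §3.3, §3.4, §4.9, §4.12] [claim: Mochizuki2012, status: disputed] for every IUT sentence quoted. Axioms: standard.
-/

noncomputable section

open Set Function NumberField IsDedekindDomain
open scoped Pointwise TensorProduct

namespace Summit.ABC.IUTFork.Conditional

/-! ## §1. The ARITHMETIC BRIDGE with a free different bound `δ` (generalises abc-iut-rh-typ-4's `not_criterion_of_not_hullCell`, `δ = e − 1`) -/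

namespace FreyHullThreshold

section Bridge

variable {ι : Type} {p : ℕ}

/-- `p^m = p^{(e·m)/e}` as a real power (`e ≠ 0`). [folklore] -/
private theorem zpow_eq_rpow_div {e : ℤ} (he : e ≠ 0) (m : ℤ) :
    ((p : ℝ) ^ m : ℝ) = (p : ℝ) ^ (((e * m : ℤ) : ℝ) / (e : ℝ)) := by
  have he' : ((e : ℤ) : ℝ) ≠ 0 := by exact_mod_cast he
  rw [← Real.rpow_intCast]
  congr 1
  push_cast
  field_simp

/-- `p^{X/e} · p^{Y/e} = p^{(X+Y)/e}`. [folklore] -/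
private theorem rpow_div_mul_rpow_div (hp : 0 < p) (e : ℤ) (X Y : ℝ) :
    (p : ℝ) ^ (X / (e : ℝ)) * (p : ℝ) ^ (Y / (e : ℝ)) = (p : ℝ) ^ ((X + Y) / (e : ℝ)) := by
  have hp0 : (0 : ℝ) < p := by exact_mod_cast hp
  rw [← Real.rpow_add hp0, add_div]

/-- `p^{X/e} ≤ p^{Y/e} ⟺ X ≤ Y` for `p > 1`, `e > 0`. [folklore] -/
private theorem rpow_div_le_iff (hp : 1 < p) {e : ℤ} (he : 0 < e) (X Y : ℝ) :
    (p : ℝ) ^ (X / (e : ℝ)) ≤ (p : ℝ) ^ (Y / (e : ℝ)) ↔ X ≤ Y := by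
  have hp1 : (1 : ℝ) < p := by exact_mod_cast hp
  have he0 : (0 : ℝ) < (e : ℝ) := by exact_mod_cast he
  rw [Real.rpow_le_rpow_left_iff hp1, div_le_div_iff_of_pos_right he0]

/-- **NEG BRIDGE with a free different bound.** With `‖t_q‖ = p^{−m_q/e}`, `‖t_Θ‖ = p^{−j²m_q/e}`, inner product
`Π_in ≥ p^{−(j+1)r_in/e}`, outer product `Π_out ≤ p^{−(j+1)r_out/e}`, all different defects `D_J ≤ j·δ/e` (`0 < e`; at a TAME place
`δ = e − 1`, in general any certified upper bound on the exponent of the different of the place, e.g. Dedekind's `e − 1 + ord(e)`), and the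
integer cell FAILING in the form `m_q − (j+1)·r_out < e·⌊(j²m_q − j·δ − (j+1)·r_in)/e⌋`, the criterion
`∀ m, (∀ J, p^m‖t_Θ‖ ≤ p^{−D_J}Π_in) → p^m‖t_q‖ ≤ Π_out` FAILS (witness `m :=` that floor). The `δ = e − 1` case is abc-iut-rh-typ-4's
`RH.HullThresholdExact.not_criterion_of_not_hullCell` (p459342). [folklore] -/
theorem not_criterion_of_cellFail (hp : 1 < p) {e mq j rin rout δ : ℤ} (he : 0 < e)
    {tq tΘ Pin Pout : ℝ} {D : ι → ℝ}
    (htq : tq = (p : ℝ) ^ (((-mq : ℤ) : ℝ) / (e : ℝ)))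
    (htΘ : tΘ = (p : ℝ) ^ (((-(j ^ 2 * mq) : ℤ) : ℝ) / (e : ℝ)))
    (hPin : (p : ℝ) ^ (((-((j + 1) * rin) : ℤ) : ℝ) / (e : ℝ)) ≤ Pin)
    (hPout : Pout ≤ (p : ℝ) ^ (((-((j + 1) * rout) : ℤ) : ℝ) / (e : ℝ)))
    (hD : ∀ J, D J ≤ ((j * δ : ℤ) : ℝ) / (e : ℝ))
    (hneg : mq - (j + 1) * rout < e * ((j ^ 2 * mq - j * δ - (j + 1) * rin) / e)) :
    ¬ ∀ m : ℤ, (∀ J, (p : ℝ) ^ m * tΘ ≤ (p : ℝ) ^ (-D J) * Pin) → (p : ℝ) ^ m * tq ≤ Pout := by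
  intro h
  have hp0 : 0 < p := by omega
  have hP0 : (0 : ℝ) < p := by exact_mod_cast hp0
  have hp1 : (1 : ℝ) < p := by exact_mod_cast hp
  have he0 : e ≠ 0 := he.ne'
  set m : ℤ := (j ^ 2 * mq - j * δ - (j + 1) * rin) / e with hm
  -- the floor property of the content
  have hme : e * m ≤ j ^ 2 * mq - j * δ - (j + 1) * rin := by
    rw [mul_comm]; exact Int.ediv_mul_le _ he0
  -- the content condition holds at `m`
  have hcont : ∀ J, (p : ℝ) ^ m * tΘ ≤ (p : ℝ) ^ (-D J) * Pin := by
    intro J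
    rw [zpow_eq_rpow_div (p := p) he0 m, htΘ, rpow_div_mul_rpow_div hp0]
    have h1 : (p : ℝ) ^ ((((e * m : ℤ) : ℝ) + ((-(j ^ 2 * mq) : ℤ) : ℝ)) / (e : ℝ)) ≤
        (p : ℝ) ^ ((((-(j * δ) : ℤ) : ℝ) + ((-((j + 1) * rin) : ℤ) : ℝ)) / (e : ℝ)) := by
      rw [rpow_div_le_iff hp he]
      exact_mod_cast (by linarith : e * m + -(j ^ 2 * mq) ≤ -(j * δ) + -((j + 1) * rin))
    have h2 : (p : ℝ) ^ ((((-(j * δ) : ℤ) : ℝ) + ((-((j + 1) * rin) : ℤ) : ℝ)) / (e : ℝ)) ≤ (p : ℝ) ^ (-D J) * Pin := by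
      rw [← rpow_div_mul_rpow_div hp0]
      have hDJ : (p : ℝ) ^ (((-(j * δ) : ℤ) : ℝ) / (e : ℝ)) ≤ (p : ℝ) ^ (-D J) := by
        apply Real.rpow_le_rpow_of_exponent_le hp1.le
        have := hD J
        have he1 : (0 : ℝ) < (e : ℝ) := by exact_mod_cast he
        rw [show (((-(j * δ) : ℤ) : ℝ) / (e : ℝ)) = -(((j * δ : ℤ) : ℝ) / (e : ℝ)) by push_cast; ring]
        linarith
      exact mul_le_mul hDJ hPin (Real.rpow_nonneg hP0.le _) (Real.rpow_nonneg hP0.le _)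
    exact h1.trans h2
  -- hence the q-condition at `m`, contradicting the failure of the cell
  have hq := (h m hcont).trans hPout
  rw [zpow_eq_rpow_div (p := p) he0 m, htq, rpow_div_mul_rpow_div hp0, rpow_div_le_iff hp he] at hq
  have hq' : e * m + -mq ≤ -((j + 1) * rout) := by exact_mod_cast hq
  linarith

/-- **Antitonicity of the cell failure in `δ`** (a SMALLER certified different bound can only make the failing cell fail harder) and in the
inner exponent; monotone in the outer exponent. [folklore] -/
theorem cellFail_mono {e mq j rin rin' rout rout' δ δ' : ℤ} (he : 0 < e) (hj : 0 ≤ j) (hrin : rin' ≤ rin) (hrout : rout ≤ rout')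
    (hδ : δ' ≤ δ) (h : mq - (j + 1) * rout < e * ((j ^ 2 * mq - j * δ - (j + 1) * rin) / e)) :
    mq - (j + 1) * rout' < e * ((j ^ 2 * mq - j * δ' - (j + 1) * rin') / e) := by
  have h1 : (j + 1) * rout ≤ (j + 1) * rout' := mul_le_mul_of_nonneg_left hrout (by linarith)
  have h2 : j ^ 2 * mq - j * δ - (j + 1) * rin ≤ j ^ 2 * mq - j * δ' - (j + 1) * rin' := by nlinarith
  have h3 := Int.ediv_le_ediv he h2
  nlinarith

end Bridge

end FreyHullThreshold

/-! ## §2. The CONSUMER at the sharp setting: the cell fails with a certified `δ` at ONE bad place ⟹ the (xi-f) licence fails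
(generalises abc-iut-rh-typ-4's `RH.HullThresholdExactRefute.not_licence_settingPrVolSharp_of_not_hullCell`, p462895, whose different hypothesis
`dSum − d_J ≤ (i+1)(e−1)/e` only holds at TAME places) -/

section Consumer

open Thm311 Thm311.Real Cor312 Cor312.Setting Cor312Vol Literature.IUT.LogThetaLattice Literature.IUT.LogVolume
open Literature.NumberTheory.NumberFields Literature.NumberTheory.GaloisRepresentations.Ultrametric

variable {F : Type} [Field F] [NumberField F] (X : PilotData F) {logv : PadicLogs F} (hlog : LogvAnalytic logv)
  (M : Type) [Field M] [NumberField M]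
  (archPk : ∀ (j : (thetaIndex X).Label) (vQ : (thetaIndex X).VQ), Set ((logShellsDH X logv).Packet j vQ))
  (archSub : ∀ (j : (thetaIndex X).Label) (v : (thetaIndex X).V),
    Set ((logShellsDH X logv).Packet j ((thetaIndex X).over v)))
  (Ψ : ℤ → ∀ v : (thetaIndex X).V, v ∈ (thetaIndex X).Vbad → Set ((logShellsDH X logv).StarPacket v))
  (act : ℤ → ∀ v : (thetaIndex X).V, v ∈ (thetaIndex X).Vbad →
    (logShellsDH X logv).StarPacket v → Module.End ℚ ((logShellsDH X logv).StarPacket v))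
  (Mmod : ℤ → ∀ j : (thetaIndex X).LabelStar, Set ((logShellsDH X logv).GlobalPacket j.1))
  (region : ℤ → ∀ j : (thetaIndex X).LabelStar, FinDivisor M → ∀ vQ : (thetaIndex X).VQ,
    Set ((logShellsDH X logv).Packet j.1 vQ))
  (n : ℤ) {HT : Type} {LogLink : HT → HT → Type} {IsFull : ∀ {s t : HT}, LogLink s t → Prop}
  (lat : LGPGaussianLogThetaLattice LogLink IsFull)
  {Frd : Type} {IsoF : Frd → Frd → Type} {Ob : Frd → Type} {realify : Frd → Frd} {Strip : Type}
  {IsoS : Strip → Strip → Type} {Mv : ∀ v : (thetaIndex X).V, v ∈ (thetaIndex X).Vbad → Type}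
  [∀ v h, Monoid (Mv v h)]
  (sig : GlobalLGPFrobenioidSignature (thetaIndex X).lstar (thetaIndex X).V (· ∈ (thetaIndex X).Vbad)
    Frd IsoF Ob realify Strip IsoS Mv)
  (split : SplittingMonoids Mv) {ObΔ : Type} {N : ∀ v : (thetaIndex X).V, v ∈ (thetaIndex X).Vbad → Type}
  [∀ v h, Monoid (N v h)] (qData : QPilotData ObΔ N)
  (tq : ∀ (pp : Nat.Primes) (x : (thetaIndex X).Fibre (.inr pp)), haveI : Fact (pp : ℕ).Prime := ⟨pp.2⟩; kOf X pp.1 x)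
  (t : ∀ (pp : Nat.Primes) (_ : Fin X.lstar) (x : (thetaIndex X).Fibre (.inr pp)),
    haveI : Fact (pp : ℕ).Prime := ⟨pp.2⟩; kOf X pp.1 x)
  (htq0 : ∀ pp x, tq pp x ≠ 0)
  (htq1 : ∀ (pp : Nat.Primes) (x : (thetaIndex X).Fibre (.inr pp)),
    haveI : Fact (pp : ℕ).Prime := ⟨pp.2⟩; placeOf X pp.1 x ∉ X.S → ‖tq pp x‖ = 1)
  (ht0 : ∀ pp i x, t pp i x ≠ 0)
  (ht : ∀ (pp : Nat.Primes) (i : Fin X.lstar) (x : (thetaIndex X).Fibre (.inr pp)),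
    haveI : Fact (pp : ℕ).Prime := ⟨pp.2⟩
    Real.log ‖t pp i x‖ = -(X.thetaPilot i (placeOf X pp.1 x)) * logNorm F (placeOf X pp.1 x) /
      localDegree F (placeOf X pp.1 x))
  (htq : ∀ (pp : Nat.Primes) (x : (thetaIndex X).Fibre (.inr pp)),
    haveI : Fact (pp : ℕ).Prime := ⟨pp.2⟩
    Real.log ‖tq pp x‖ = -(X.qPilot (placeOf X pp.1 x)) * logNorm F (placeOf X pp.1 x) /
      localDegree F (placeOf X pp.1 x))
  (cin cout : ∀ (pp : Nat.Primes) (x : (thetaIndex X).Fibre (.inr pp)),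
    haveI : Fact (pp : ℕ).Prime := ⟨pp.2⟩; (presAt X hlog pp).k x)
  (hin0 : ∀ pp x, cin pp x ≠ 0)
  (hin : ∀ (pp : Nat.Primes) (x : (thetaIndex X).Fibre (.inr pp)), haveI : Fact (pp : ℕ).Prime := ⟨pp.2⟩;
    ∀ o : (presAt X hlog pp).k x, ‖o‖ ≤ 1 → cin pp x * o ∈ logUnits ((presAt X hlog pp).k x))
  (hmax : ∀ (pp : Nat.Primes) (x : (thetaIndex X).Fibre (.inr pp)), haveI : Fact (pp : ℕ).Prime := ⟨pp.2⟩;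
    ∃ (ϖ : ((presAt X hlog pp).k x)ˣ) (w : (presAt X hlog pp).k x),
      IsUniformizer ϖ ∧ w ∉ logUnits ((presAt X hlog pp).k x) ∧ ‖w‖ * ‖(ϖ : (presAt X hlog pp).k x)‖ ≤ ‖cin pp x‖)
  (hout0 : ∀ pp x, cout pp x ≠ 0)
  (houtΛ : ∀ (pp : Nat.Primes) (x : (thetaIndex X).Fibre (.inr pp)), haveI : Fact (pp : ℕ).Prime := ⟨pp.2⟩;
    cout pp x ∈ logUnits ((presAt X hlog pp).k x))
  (hdom : ∀ (pp : Nat.Primes) (x : (thetaIndex X).Fibre (.inr pp)), haveI : Fact (pp : ℕ).Prime := ⟨pp.2⟩;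
    ∀ z ∈ logUnits ((presAt X hlog pp).k x), ‖z‖ ≤ ‖cout pp x‖)

/-- `(p^{X/e})^N = p^{(N·X)/e}` for `p > 0`. [folklore] -/
private theorem rpow_div_pow {p : ℕ} (hp : 0 < p) (e : ℝ) (Xr : ℝ) (N : ℕ) :
    ((p : ℝ) ^ (Xr / e)) ^ N = (p : ℝ) ^ (((N : ℝ) * Xr) / e) := by
  have hp0 : (0 : ℝ) ≤ p := by positivity
  rw [← Real.rpow_natCast, ← Real.rpow_mul hp0]
  congr 1
  ring

include ht0 ht htq hin0 hin hmax hout0 houtΛ hdom in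
/-- **THE LICENCE FAILS WHEN THE CELL FAILS WITH A CERTIFIED DIFFERENT BOUND AT ONE BAD PLACE.** Realising Θ- and q-ideles; a fibre point
`w | p` with integral pilot degree `P_q(w) = P`, ramification index `e = ramIdx F w`; a LOWER bound `p^{−r_in/e} ≤ ‖cin w‖` on the inner radius and an
UPPER bound `‖cout w‖ ≤ p^{−r_out/e}` on the outer radius (abc-iut-w4-d036's binders); the different defects of the DIAGONAL packet `(w, …, w)` at label
`i+1` bounded by `(i+1)·δ/e` for an integer `δ` (e.g. `δ = e − 1` at a tame place, Dedekind's `e − 1 + ord_w(e)` always); and the cell failure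
`P − (i+2)·r_out < e·⌊((i+1)²P − (i+1)δ − (i+2)r_in)/e⌋`. THEN abc-iut-c312-1's `Thm311ToCor312.Licence` FAILS at `settingPrVolSharp X …` (via the
U2-LICENCE-WRAPPER `licence_settingPrVolSharp_iff_shellRadii_of_realises`, p460573, at the diagonal summand, and §1).
[cite: DupuyHilado2025, §3.4, §4.9, §4.12] [cite: Mochizuki2012, IUTchIII Cor. 3.12 Step (xi-f) p. 184; IUTchIV Prop. 1.1 p. 9, Prop. 1.2 (i)(ii) p. 10]
[claim: Mochizuki2012, status: disputed] -/
theorem not_licence_settingPrVolSharp_of_cellFail (pp : Nat.Primes) (i : Fin (thetaIndex X).lstar)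
    (w : (thetaIndex X).Fibre (.inr pp)) {P : ℕ}
    (hP : haveI : Fact (pp : ℕ).Prime := ⟨pp.2⟩; X.qPilot (placeOf X pp.1 w) = P)
    {rin rout δ : ℤ}
    (hcin : haveI : Fact (pp : ℕ).Prime := ⟨pp.2⟩
      ((pp : ℕ) : ℝ) ^ (((-rin : ℤ) : ℝ) / ((ramIdx F (placeOf X pp.1 w) : ℤ) : ℝ)) ≤ ‖cin pp w‖)
    (hcout : haveI : Fact (pp : ℕ).Prime := ⟨pp.2⟩
      ‖cout pp w‖ ≤ ((pp : ℕ) : ℝ) ^ (((-rout : ℤ) : ℝ) / ((ramIdx F (placeOf X pp.1 w) : ℤ) : ℝ)))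
    (hd : haveI : Fact (pp : ℕ).Prime := ⟨pp.2⟩
      ∀ J : DIdx (pp : ℕ) ((presAt X hlog pp).kk (fun _ : (thetaIndex X).Caps (Setting.labelSucc i) => w)),
        dSum (pp : ℕ) ((presAt X hlog pp).kk (fun _ : (thetaIndex X).Caps (Setting.labelSucc i) => w)) -
            differentOrd (pp : ℕ) (DFac (pp : ℕ) ((presAt X hlog pp).kk (fun _ : (thetaIndex X).Caps (Setting.labelSucc i) => w)) J) ≤
          (((((i : ℕ) : ℤ) + 1) * δ : ℤ) : ℝ) / ((ramIdx F (placeOf X pp.1 w) : ℤ) : ℝ))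
    (hneg : haveI : Fact (pp : ℕ).Prime := ⟨pp.2⟩
      (P : ℤ) - ((((i : ℕ) : ℤ) + 1) + 1) * rout <
        (ramIdx F (placeOf X pp.1 w) : ℤ) * (((((i : ℕ) : ℤ) + 1) ^ 2 * (P : ℤ) - (((i : ℕ) : ℤ) + 1) * δ -
          ((((i : ℕ) : ℤ) + 1) + 1) * rin) / (ramIdx F (placeOf X pp.1 w) : ℤ))) :
    ¬ Thm311ToCor312.Licence (settingPrVolSharp X hlog M archPk archSub Ψ act Mmod region n lat sig split qData tq t htq0 htq1) := by
  haveI : Fact (pp : ℕ).Prime := ⟨pp.2⟩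
  intro hL
  have hall := (licence_settingPrVolSharp_iff_shellRadii_of_realises X hlog M archPk archSub Ψ act Mmod region n lat sig split qData tq t
    htq0 htq1 ht0 ht htq cin cout hin0 hin hmax hout0 houtΛ hdom).1 hL pp i (fun _ => w)
  obtain ⟨σ, hσ⟩ := hall
  -- abbreviations
  set e : ℤ := (ramIdx F (placeOf X pp.1 w) : ℤ) with he_def
  have he0' : 0 < ramIdx F (placeOf X pp.1 w) := Nat.pos_of_ne_zero (ramIdx_ne_zero F _)
  have he : 0 < e := by rw [he_def]; exact_mod_cast he0'
  have hp1 : 1 < (pp : ℕ) := pp.2.one_lt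
  have hp0 : 0 < (pp : ℕ) := pp.2.pos
  have hP0 : (0 : ℝ) ≤ ((pp : ℕ) : ℝ) := by positivity
  have hcard : Fintype.card ((thetaIndex X).Caps (Setting.labelSucc i)) = (i : ℕ) + 2 := by
    rw [Fintype.card_fin]
    simp only [Setting.labelSucc, Fin.val_succ]
  -- the products of the (constant) radii
  have hPin : ((pp : ℕ) : ℝ) ^ (((-(((((i : ℕ) : ℤ) + 1) + 1) * rin) : ℤ) : ℝ) / (e : ℝ)) ≤
      ∏ _a : (thetaIndex X).Caps (Setting.labelSucc i), ‖cin pp w‖ := by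
    rw [Finset.prod_const, Finset.card_univ, hcard]
    have h1 : (((pp : ℕ) : ℝ) ^ (((-rin : ℤ) : ℝ) / (e : ℝ))) ^ ((i : ℕ) + 2) ≤ ‖cin pp w‖ ^ ((i : ℕ) + 2) :=
      pow_le_pow_left₀ (Real.rpow_nonneg hP0 _) hcin _
    rw [rpow_div_pow hp0] at h1
    convert h1 using 2
    push_cast; ring
  have hPout : ∏ _a : (thetaIndex X).Caps (Setting.labelSucc i), ‖cout pp w‖ ≤
      ((pp : ℕ) : ℝ) ^ (((-(((((i : ℕ) : ℤ) + 1) + 1) * rout) : ℤ) : ℝ) / (e : ℝ)) := by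
    rw [Finset.prod_const, Finset.card_univ, hcard]
    have h1 : ‖cout pp w‖ ^ ((i : ℕ) + 2) ≤ (((pp : ℕ) : ℝ) ^ (((-rout : ℤ) : ℝ) / (e : ℝ))) ^ ((i : ℕ) + 2) :=
      pow_le_pow_left₀ (norm_nonneg _) hcout _
    rw [rpow_div_pow hp0] at h1
    convert h1 using 2
    push_cast; ring
  -- the realising norms in the bridge's currency
  have htq' : ((pp : ℕ) : ℝ) ^ (-(X.qPilot (placeOf X pp.1 w)) / (ramIdx F (placeOf X pp.1 w) : ℝ)) =
      ((pp : ℕ) : ℝ) ^ (((-(P : ℤ) : ℤ) : ℝ) / (e : ℝ)) := by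
    rw [hP]; congr 1; push_cast; rw [he_def]; push_cast; ring
  have htΘ' : ((pp : ℕ) : ℝ) ^ (-((((i : ℕ) + 1 : ℕ) : ℝ) ^ 2 * X.qPilot (placeOf X pp.1 w)) / (ramIdx F (placeOf X pp.1 w) : ℝ)) =
      ((pp : ℕ) : ℝ) ^ (((-((((i : ℕ) : ℤ) + 1) ^ 2 * (P : ℤ)) : ℤ) : ℝ) / (e : ℝ)) := by
    rw [hP]; congr 1; push_cast; rw [he_def]; push_cast; ring
  -- the bridge
  refine FreyHullThreshold.not_criterion_of_cellFail (p := (pp : ℕ)) (ι := DIdx (pp : ℕ) ((presAt X hlog pp).kk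
      (fun _ : (thetaIndex X).Caps (Setting.labelSucc i) => w))) hp1 he (D := fun J =>
      dSum (pp : ℕ) ((presAt X hlog pp).kk (fun _ : (thetaIndex X).Caps (Setting.labelSucc i) => w)) -
        differentOrd (pp : ℕ) (DFac (pp : ℕ) ((presAt X hlog pp).kk (fun _ : (thetaIndex X).Caps (Setting.labelSucc i) => w)) J))
    htq' htΘ' hPin hPout ?_ hneg ?_
  · intro J
    have := hd J
    convert this using 2
  · intro m hm
    have := hσ m (fun J => by simpa using hm J)
    simpa using this

include ht0 ht htq hin0 hin hmax hout0 houtΛ hdom in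
/-- **… hence BRANCH C's per-datum antecedent FAILS**: under the same hypotheses there are NO `ρ`, `qK` with `QPinned ∧ PilotKummerCompatHull` at
`settingPrVolSharp X …` (any columns `col`; the binder `hSHw`'s shape) — realising q-ideles have norm `≤ 1` (`norm_qIdele_le_one_of_realises`),
`exists_qPinned_and_hull_settingPrVolSharp_iff_licence`. [cite: DupuyHilado2025, §3.4, §4.9, §4.12]
[cite: Mochizuki2012, IUTchIII Cor. 3.12 Step (xi-d) p. 183, (xi-f) p. 184] [claim: Mochizuki2012, status: disputed] -/
theorem not_exists_qPinned_and_hull_settingPrVolSharp_of_cellFail (col : ℤ → Column (logShellsDH X logv)) (pp : Nat.Primes)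
    (i : Fin (thetaIndex X).lstar) (w : (thetaIndex X).Fibre (.inr pp)) {P : ℕ}
    (hP : haveI : Fact (pp : ℕ).Prime := ⟨pp.2⟩; X.qPilot (placeOf X pp.1 w) = P)
    {rin rout δ : ℤ}
    (hcin : haveI : Fact (pp : ℕ).Prime := ⟨pp.2⟩
      ((pp : ℕ) : ℝ) ^ (((-rin : ℤ) : ℝ) / ((ramIdx F (placeOf X pp.1 w) : ℤ) : ℝ)) ≤ ‖cin pp w‖)
    (hcout : haveI : Fact (pp : ℕ).Prime := ⟨pp.2⟩
      ‖cout pp w‖ ≤ ((pp : ℕ) : ℝ) ^ (((-rout : ℤ) : ℝ) / ((ramIdx F (placeOf X pp.1 w) : ℤ) : ℝ)))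
    (hd : haveI : Fact (pp : ℕ).Prime := ⟨pp.2⟩
      ∀ J : DIdx (pp : ℕ) ((presAt X hlog pp).kk (fun _ : (thetaIndex X).Caps (Setting.labelSucc i) => w)),
        dSum (pp : ℕ) ((presAt X hlog pp).kk (fun _ : (thetaIndex X).Caps (Setting.labelSucc i) => w)) -
            differentOrd (pp : ℕ) (DFac (pp : ℕ) ((presAt X hlog pp).kk (fun _ : (thetaIndex X).Caps (Setting.labelSucc i) => w)) J) ≤
          (((((i : ℕ) : ℤ) + 1) * δ : ℤ) : ℝ) / ((ramIdx F (placeOf X pp.1 w) : ℤ) : ℝ))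
    (hneg : haveI : Fact (pp : ℕ).Prime := ⟨pp.2⟩
      (P : ℤ) - ((((i : ℕ) : ℤ) + 1) + 1) * rout <
        (ramIdx F (placeOf X pp.1 w) : ℤ) * (((((i : ℕ) : ℤ) + 1) ^ 2 * (P : ℤ) - (((i : ℕ) : ℤ) + 1) * δ -
          ((((i : ℕ) : ℤ) + 1) + 1) * rin) / (ramIdx F (placeOf X pp.1 w) : ℤ))) :
    ¬ ∃ (ρ : (∀ v : (thetaIndex X).V, v ∈ (thetaIndex X).Vbad → Set ((logShellsDH X logv).StarPacket v)) →
          ∀ (j : (thetaIndex X).Label) (vQ : (thetaIndex X).VQ), Set ((logShellsDH X logv).Packet j vQ))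
        (qK : ∀ v : (thetaIndex X).V, v ∈ (thetaIndex X).Vbad → Set ((logShellsDH X logv).StarPacket v)),
        QPinned ({ toSituation := situationPrVol X hlog M archPk archSub Ψ act Mmod region, col := col } :
            LatticeSituation (thetaIndex X))
          (settingPrVolSharp X hlog M archPk archSub Ψ act Mmod region n lat sig split qData tq t htq0 htq1) ρ qK ∧
        PilotKummerCompatHull ({ toSituation := situationPrVol X hlog M archPk archSub Ψ act Mmod region, col := col } :
            LatticeSituation (thetaIndex X))
          (settingPrVolSharp X hlog M archPk archSub Ψ act Mmod region n lat sig split qData tq t htq0 htq1) ρ qK := by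
  intro h
  have hL := (exists_qPinned_and_hull_settingPrVolSharp_iff_licence X hlog M archPk archSub Ψ act Mmod region n lat sig split qData tq t
    htq0 htq1 col (fun pp x => norm_qIdele_le_one_of_realises X tq htq0 htq pp x)).1 h
  exact not_licence_settingPrVolSharp_of_cellFail X hlog M archPk archSub Ψ act Mmod region n lat sig split qData tq t htq0 htq1 ht0 ht
    htq cin cout hin0 hin hmax hout0 houtΛ hdom pp i w hP hcin hcout hd hneg hL

end Consumer

end Summit.ABC.IUTFork.Conditional

end
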